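import Literature.NumberTheory.GaloisRepresentations.ArtinRepresentationDifferentProofs
import HarnessLib

/-!
# Hasse–Arf for cyclic groups, I: totally ramified primes of a Galois extension of Dedekind domains
(Serre, *Local Fields*, Ch. IV §1 and Ch. V §7, global form)

This is the first of a series of files proving **Serre's Proposition V.11** — *for a cyclic
extension `L/K`, totally ramified at `𝔓`, with `μ` the largest integer such that `G_μ ≠ 1`,
`φ_{L/K}(μ)` is an integer* — in the **global** setting used by the tree's named fact
`Literature.NumberTheory.GaloisRepresentations.hasseArf` (`ArtinRepresentation.lean`): `R` a
Dedekind domain with fraction field `K`, `L/K` finite Galois with group `G`, `S = integralClosure R L`,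
`𝔓` a non-zero maximal ideal of `S` whose inertia group is all of `G` ("`𝔓` totally ramified")
and whose residue extension is separable.  By `hasseArf_of_cyclic`
(`HasseArfReductionProofs.lean`, Serre's "Prop. 11 implies Thm. 1") this proposition is the only
missing input of the Hasse–Arf theorem, hence (through `ArtinConductorExponentHasseArfProofs`) of
the `ℓ`-adic integrality of the Artin conductor (`exists_natCast_eq_artinConductorAt_lAdic`).

Mathlib has no completion of a Dedekind domain at a prime together with its Galois theory, so
Serre's proof (Ch. V §§3, 6, 7), which works in a complete field, is re-done inside the global
ring `S` with the `𝔓`-adic order `ord 𝔓 : S → ℕ∞` of `RamificationGalois.lean`; the surjectivity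
statements about the norm on unit groups (Ch. V §6 Cor. 3), which need completeness, are replaced
in the later files by approximation statements.  This file collects the elementary consequences
of total ramification:

* `Literature.NumberTheory.GaloisRepresentations.isInvariant_integralClosure`,
  `…isGaloisGroup_integralClosure` — `S^G = R` (Galois theory + integral closedness), so that
  Mathlib's Hilbert theory (`IsGaloisGroup`) applies to `G` acting on `S` over `R`;
* `…smul_eq_of_inertia_eq_top` — every `g ∈ G` fixes `𝔓`;
* `…exists_algebraMap_sub_mem_of_inertia_eq_top` — **`f = 1`**: every residue class mod `𝔓` is
  represented by an element of `R` (Serre I §7 Prop. 21 c));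
* `…ramificationIdx'_under_eq_card`, `…ord_algebraMap_eq_card_mul` — **`e = |G|`**:
  `v_𝔓 = |G| · v_𝔭` on `R` (Serre I §7 Cor. to Prop. 21);
* `…ord_smul_eq`, `…ord_prod_smul` — `v_𝔓(g b) = v_𝔓(b)`, `v_𝔓(N b) = |G| v_𝔓(b)`;
* `…lowerIndex_eq_ord_smul_sub` — **`i_G(g) = v_𝔓(g π - π)`** for a uniformizer `π`
  (Serre IV §1 Lemma 1 / §2 Prop. 5, via the tree's uniformizer criterion);
* `…card_ramificationSubgroup_dvd`, `…exists_sum_card_ramificationSubgroup_eq_mul` — `g_{j} ∣ g_i`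
  for `i ≤ j`, and **`ψ` takes integers to integers**: for every `n` there is `m` with
  `Σ_{i=1}^{m} g_i = g_0 · n` (Serre IV §3 Prop. 13);
* `…exists_natCast_eq_herbrandPhi_of_dvd` — `g_0 ∣ Σ_{i=0}^{μ} g_i ⇒ φ(μ) ∈ ℕ` (Serre IV §3,
  `φ(m) + 1 = (1/g_0) Σ_{i=0}^{m} g_i`), the form in which Prop. V.11 will be proved.

## References

* J.-P. Serre, *Local Fields*, GTM 67, Springer 1979: Ch. I §7 Prop. 21 and Cor.; Ch. IV §1
  Lemma 1, Prop. 2, §2 Prop. 5, §3 Prop. 13 and p. 74 (`φ(m)+1 = g_0⁻¹ Σ g_i`); Ch. V §7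
  Prop. 11. [SerreLocalFields1979]
-/

noncomputable section

open scoped Pointwise

namespace Literature.NumberTheory.GaloisRepresentations

/-! ### Every element of the inertia group fixes the ideal -/

section General

variable {A : Type*} [CommRing A] {Γ : Type*} [Group Γ] [MulSemiringAction Γ A]

/-- If the inertia group of `P` is all of `Γ`, every `g ∈ Γ` fixes `P`.
Ref: Serre, *Local Fields*, Ch. I §7 (`T ⊆ D`). [folklore] -/
theorem smul_eq_of_inertia_eq_top {P : Ideal A} (htot : P.inertia Γ = ⊤) (g : Γ) : g • P = P :=
  P.inertia_le_stabilizer (show g ∈ P.inertia Γ from htot ▸ Subgroup.mem_top g)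

end General

variable (R : Type*) {K L : Type*} [CommRing R] [IsDedekindDomain R] [Field K] [Field L]
  [Algebra R K] [IsFractionRing R K] [Algebra R L] [Algebra K L] [IsScalarTower R K L]

/-! ### `S^G = R`: `G = Gal(L/K)` is a Galois group for `S/R` -/

section Invariants

omit [IsDedekindDomain R] in
include K in
/-- `R → S = integralClosure R L` is injective (`R → K → L` is). [folklore] -/
theorem faithfulSMul_integralClosure : FaithfulSMul R (integralClosure R L) := by
  rw [faithfulSMul_iff_algebraMap_injective]
  intro x y h
  have h' : algebraMap R L x = algebraMap R L y := congrArg Subtype.val h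
  rw [IsScalarTower.algebraMap_apply R K L, IsScalarTower.algebraMap_apply R K L] at h'
  exact IsFractionRing.injective R K ((algebraMap K L).injective h')

variable [FiniteDimensional K L] [IsGalois K L]

/-- **`S^G = R`.**  An element of `S = integralClosure R L` fixed by `G = Gal(L/K)` lies in `K`
(Galois theory) and is integral over the integrally closed `R`, hence comes from `R`
(Mathlib's `Algebra.isInvariant_of_isGalois`, restated for Mathlib's action of `L ≃ₐ[K] L` on the
subalgebra `integralClosure R L`).  Ref: Serre, *Local Fields*, Ch. I §7 (`A = B^G ∩ K`). [folklore] -/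
theorem isInvariant_integralClosure :
    Algebra.IsInvariant R (integralClosure R L) (L ≃ₐ[K] L) := by
  refine ⟨fun b hb => ?_⟩
  have hb' : (b : L) ∈ IntermediateField.fixedField (⊤ : Subgroup (L ≃ₐ[K] L)) := by
    rintro ⟨g, -⟩
    exact congrArg Subtype.val (hb g)
  have htop : IntermediateField.fixedField (⊤ : Subgroup (L ≃ₐ[K] L)) = ⊥ :=
    ((IsGalois.tfae (F := K) (E := L)).out 0 1).mp (inferInstance : IsGalois K L)
  rw [htop, IntermediateField.mem_bot] at hb'
  obtain ⟨c, hc⟩ := hb'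
  have hbi : IsIntegral R (b : L) := b.2
  rw [← hc, isIntegral_algebraMap_iff (algebraMap K L).injective] at hbi
  obtain ⟨a, rfl⟩ := IsIntegrallyClosed.algebraMap_eq_of_integral hbi
  refine ⟨a, Subtype.ext ?_⟩
  rw [Subalgebra.coe_algebraMap, IsScalarTower.algebraMap_apply R K L]
  exact hc

/-- `Gal(L/K)` is a Galois group for `S/R` in Mathlib's sense (`IsGaloisGroup`: faithful by
`faithfulSMul_algEquiv_integralClosure`, commuting with `R`, invariants `R`).
Ref: Serre, *Local Fields*, Ch. I §7. [folklore] -/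
theorem isGaloisGroup_integralClosure :
    IsGaloisGroup (L ≃ₐ[K] L) R (integralClosure R L) :=
  ⟨faithfulSMul_algEquiv_integralClosure R, inferInstance, isInvariant_integralClosure R⟩

end Invariants

/-! ### Total ramification: `𝔓` is fixed by `G`, `f = 1`, `e = |G|` -/

section TotallyRamified

variable [FiniteDimensional K L] [IsGalois K L] (𝔓 : Ideal (integralClosure R L)) [𝔓.IsMaximal]

/-- **`f(𝔓|𝔭) = 1` for a totally ramified prime**: every residue class of `S` mod `𝔓` contains
an element of `R`.  (The residue classes are represented by inertia invariants,
`exists_inertia_fixed_sub_mem`, i.e. by `G`-invariants, which lie in `R`.)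
Ref: Serre, *Local Fields*, Ch. I §7, Prop. 21 c) and Cor. (`K̄_T = L̄`).
[cite: SerreLocalFields1979, Ch. I §7 Prop. 21 c) and Cor.] -/
theorem exists_algebraMap_sub_mem_of_inertia_eq_top
    [Algebra.IsSeparable (R ⧸ 𝔓.under R) (integralClosure R L ⧸ 𝔓)]
    (htot : 𝔓.inertia (L ≃ₐ[K] L) = ⊤) (b : integralClosure R L) :
    ∃ a : R, b - algebraMap R (integralClosure R L) a ∈ 𝔓 := by
  haveI : Finite (L ≃ₐ[K] L) := inferInstance
  haveI : 𝔓.LiesOver (𝔓.under R) := ⟨rfl⟩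
  haveI : (𝔓.under R).IsMaximal := Ideal.IsMaximal.under R 𝔓
  obtain ⟨b₀, hfix, hb⟩ := exists_inertia_fixed_sub_mem (L ≃ₐ[K] L) (𝔓.under R) 𝔓 b
  obtain ⟨a, ha⟩ := (isInvariant_integralClosure R (K := K) (L := L)).isInvariant b₀
    fun g => hfix g (htot ▸ Subgroup.mem_top g)
  exact ⟨a, by rwa [ha]⟩

omit [IsDedekindDomain R] in
/-- Units of `R` mod `𝔭`: if `a ∈ R ∖ 𝔭` there is `a' ∈ R` with `a a' ≡ 1 (mod 𝔓)`.
Ref: Serre, *Local Fields*, Ch. I §7. [folklore] -/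
theorem exists_mul_algebraMap_sub_one_mem {a : R} (ha : algebraMap R (integralClosure R L) a ∉ 𝔓) :
    ∃ a' : R, algebraMap R (integralClosure R L) a * algebraMap R _ a' - 1 ∈ 𝔓 := by
  haveI : (𝔓.under R).IsMaximal := Ideal.IsMaximal.under R 𝔓
  have ha' : a ∉ 𝔓.under R := ha
  obtain ⟨a', ha'⟩ := Ideal.Quotient.exists_inv (I := 𝔓.under R)
    (mt (Ideal.Quotient.eq_zero_iff_mem).mp ha')
  obtain ⟨a', rfl⟩ := Ideal.Quotient.mk_surjective a'
  refine ⟨a', ?_⟩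
  rw [← map_mul, ← map_one (Ideal.Quotient.mk (𝔓.under R)), Ideal.Quotient.eq,
    Ideal.under_def, Ideal.mem_comap, map_sub, map_one, map_mul] at ha'
  exact ha'

/-- **`e(𝔓|𝔭) = |G|` for a totally ramified prime** with separable residue extension
(`Card T_𝔓 = e`, `card_inertia_eq_ramificationIdxIn_of_isSeparable`, and `T_𝔓 = G`).
Ref: Serre, *Local Fields*, Ch. I §7, Cor. to Prop. 21. [cite: SerreLocalFields1979, Ch. I §7 Cor. to Prop. 21] -/
theorem ramificationIdx'_under_eq_card [Algebra.IsSeparable (R ⧸ 𝔓.under R) (integralClosure R L ⧸ 𝔓)]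
    (h𝔓 : 𝔓 ≠ ⊥) (htot : 𝔓.inertia (L ≃ₐ[K] L) = ⊤) :
    (𝔓.under R).ramificationIdx' 𝔓 = Nat.card (L ≃ₐ[K] L) := by
  haveI := isGaloisGroup_integralClosure R (K := K) (L := L)
  haveI := faithfulSMul_integralClosure R (K := K) (L := L)
  haveI : IsDedekindDomain (integralClosure R L) := integralClosure.isDedekindDomain R K L
  haveI : Module.Finite R (integralClosure R L) :=
    IsIntegralClosure.finite R K L (integralClosure R L)
  haveI : Module.IsTorsionFree R (integralClosure R L) := by
    rw [Module.isTorsionFree_iff_faithfulSMul]; infer_instance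
  haveI : 𝔓.LiesOver (𝔓.under R) := ⟨rfl⟩
  haveI : (𝔓.under R).IsMaximal := Ideal.IsMaximal.under R 𝔓
  have hp : 𝔓.under R ≠ ⊥ := Ideal.IsIntegral.comap_ne_bot _ h𝔓
  rw [Ideal.ramificationIdx'_eq_ramificationIdx _ 𝔓 hp,
    ← Ideal.ramificationIdxIn_eq_ramificationIdx (𝔓.under R) 𝔓 (L ≃ₐ[K] L),
    ← card_inertia_eq_ramificationIdxIn_of_isSeparable (G := L ≃ₐ[K] L) (𝔓.under R) 𝔓, htot,
    Subgroup.card_top]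

/-- **`v_𝔓(a) = |G| · v_𝔭(a)` for `a ∈ R`** at a totally ramified prime.
Ref: Serre, *Local Fields*, Ch. I §4 (before Prop. 11) and §7 Cor. to Prop. 21.
[cite: SerreLocalFields1979, Ch. I §7 Cor. to Prop. 21] -/
theorem ord_algebraMap_eq_card_mul [Algebra.IsSeparable (R ⧸ 𝔓.under R) (integralClosure R L ⧸ 𝔓)]
    (h𝔓 : 𝔓 ≠ ⊥) (htot : 𝔓.inertia (L ≃ₐ[K] L) = ⊤) (a : R) :
    ord 𝔓 (algebraMap R (integralClosure R L) a) = Nat.card (L ≃ₐ[K] L) * ord (𝔓.under R) a := by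
  haveI : IsDedekindDomain (integralClosure R L) := integralClosure.isDedekindDomain R K L
  haveI := faithfulSMul_integralClosure R (K := K) (L := L)
  haveI : 𝔓.LiesOver (𝔓.under R) := ⟨rfl⟩
  have hp : 𝔓.under R ≠ ⊥ := Ideal.IsIntegral.comap_ne_bot _ h𝔓
  rw [← ramificationIdx'_under_eq_card R 𝔓 h𝔓 htot]
  by_cases ha : a = 0
  · subst ha
    rw [map_zero, ord_zero, ord_zero, ENat.mul_top]
    exact_mod_cast Ideal.IsDedekindDomain.ramificationIdx'_ne_zero (Ideal.map_ne_bot_of_ne_bot hp)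
      inferInstance (Ideal.map_le_iff_le_comap.mpr le_rfl)
  have hspan : Ideal.span {a} ≠ ⊥ := by rwa [Ne, Ideal.span_singleton_eq_bot]
  have key := Ideal.IsDedekindDomain.emultiplicity_map_eq_ramificationIdx'_mul
    (S := integralClosure R L) (w := 𝔓) hspan
    (Ideal.prime_of_isPrime hp inferInstance).irreducible
    (Ideal.prime_of_isPrime h𝔓 inferInstance).irreducible h𝔓
  rw [Ideal.map_span, Set.image_singleton] at key
  rw [ord, ord]
  exact key

omit [IsDedekindDomain R] [IsFractionRing R K] [FiniteDimensional K L] [IsGalois K L]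
  [𝔓.IsMaximal] in
/-- `v_𝔓(g b) = v_𝔓(b)` for every `g ∈ G` at a totally ramified prime.
Ref: Serre, *Local Fields*, Ch. I §7 (`D` preserves `v_𝔓`). [folklore] -/
theorem ord_smul_eq [IsDedekindDomain (integralClosure R L)] (htot : 𝔓.inertia (L ≃ₐ[K] L) = ⊤)
    (g : L ≃ₐ[K] L) (b : integralClosure R L) : ord 𝔓 (g • b) = ord 𝔓 b :=
  ord_smul 𝔓 (smul_eq_of_inertia_eq_top htot g) b

/-- **`v_𝔓(∏_g g b) = |G| · v_𝔓(b)`**: the valuation of the norm at a totally ramified prime.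
Ref: Serre, *Local Fields*, Ch. II §2, Cor. 3 to Prop. 3 (`v(N x) = n v(x)` when the
valuation is the unique extension). [folklore] -/
theorem ord_prod_smul (h𝔓 : 𝔓 ≠ ⊥) (htot : 𝔓.inertia (L ≃ₐ[K] L) = ⊤)
    (b : integralClosure R L) :
    ord 𝔓 (∏ g : L ≃ₐ[K] L, g • b) = Nat.card (L ≃ₐ[K] L) * ord 𝔓 b := by
  classical
  haveI : IsDedekindDomain (integralClosure R L) := integralClosure.isDedekindDomain R K L
  rw [ord_prod 𝔓 h𝔓, Finset.sum_congr rfl fun g _ => ord_smul_eq R 𝔓 htot g b,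
    Finset.sum_const, Finset.card_univ, Nat.card_eq_fintype_card, nsmul_eq_mul]

/-- The norm `∏_g g b` of an element of `S` is `G`-invariant, hence comes from `R`.
Ref: Serre, *Local Fields*, Ch. I §7. [folklore] -/
theorem exists_prod_smul_eq_algebraMap (b : integralClosure R L) :
    ∃ a : R, ∏ g : L ≃ₐ[K] L, g • b = algebraMap R (integralClosure R L) a := by
  classical
  obtain ⟨a, ha⟩ := (isInvariant_integralClosure R (K := K) (L := L)).isInvariant
    (∏ g : L ≃ₐ[K] L, g • b) fun g => by
      rw [Finset.smul_prod']
      simp_rw [smul_smul]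
      exact Fintype.prod_equiv (Equiv.mulLeft g) _ _ fun _ => rfl
  exact ⟨a, ha.symm⟩

/-- The trace `Σ_g g b` of an element of `S` is `G`-invariant, hence comes from `R`.
Ref: Serre, *Local Fields*, Ch. I §7. [folklore] -/
theorem exists_sum_smul_eq_algebraMap (b : integralClosure R L) :
    ∃ a : R, ∑ g : L ≃ₐ[K] L, g • b = algebraMap R (integralClosure R L) a := by
  classical
  obtain ⟨a, ha⟩ := (isInvariant_integralClosure R (K := K) (L := L)).isInvariant
    (∑ g : L ≃ₐ[K] L, g • b) fun g => by
      rw [Finset.smul_sum]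
      simp_rw [smul_smul]
      exact Fintype.sum_equiv (Equiv.mulLeft g) _ _ fun _ => rfl
  exact ⟨a, ha.symm⟩

/-- A `G`-fixed element of `S` has `𝔓`-order divisible by `|G|` (it comes from `R`, and
`v_𝔓 = |G| v_𝔭` on `R`).  This is the valuation-theoretic fact behind the last step of Serre's
proof of Prop. V.11 ("as `L/K` is totally ramified, `w(z) ≡ 0 mod r`").
Ref: Serre, *Local Fields*, Ch. V §7, proof of Prop. 11 (p. 96). [cite: SerreLocalFields1979, Ch. V §7 Prop. 11 (proof)] -/
theorem card_dvd_ord_of_forall_smul_eq [Algebra.IsSeparable (R ⧸ 𝔓.under R) (integralClosure R L ⧸ 𝔓)]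
    (h𝔓 : 𝔓 ≠ ⊥) (htot : 𝔓.inertia (L ≃ₐ[K] L) = ⊤) {z : integralClosure R L} (hz0 : z ≠ 0)
    (hz : ∀ g : L ≃ₐ[K] L, g • z = z) :
    ∃ k : ℕ, ord 𝔓 z = (Nat.card (L ≃ₐ[K] L) * k : ℕ) := by
  haveI : IsDedekindDomain (integralClosure R L) := integralClosure.isDedekindDomain R K L
  obtain ⟨a, ha⟩ := (isInvariant_integralClosure R (K := K) (L := L)).isInvariant z hz
  have ha0 : a ≠ 0 := by rintro rfl; exact hz0 (by rw [← ha, map_zero])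
  have hfin : ord (𝔓.under R) a ≠ ⊤ := by
    rw [ord, Ne, emultiplicity_eq_top, not_not]
    exact FiniteMultiplicity.of_prime_left
      (Ideal.prime_of_isPrime (Ideal.IsIntegral.comap_ne_bot _ h𝔓) inferInstance)
      (by rwa [Ne, Submodule.zero_eq_bot, Ideal.span_singleton_eq_bot])
  obtain ⟨k, hk⟩ := ENat.ne_top_iff_exists.mp hfin
  refine ⟨k, ?_⟩
  rw [← ha, ord_algebraMap_eq_card_mul R 𝔓 h𝔓 htot, ← hk]
  norm_cast

end TotallyRamified

/-! ### `i_G(g) = v_𝔓(g π - π)` and the ramification numbers of a totally ramified prime -/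

section LowerNumbering

variable [FiniteDimensional K L] [IsGalois K L] (𝔓 : Ideal (integralClosure R L)) [𝔓.IsMaximal]
  [Algebra.IsSeparable (R ⧸ 𝔓.under R) (integralClosure R L ⧸ 𝔓)]

/-- **`i_G(g) = v_𝔓(g π - π)`** at a totally ramified prime, for every `g ∈ G` and every
uniformizer `π ∈ 𝔓 ∖ 𝔓²` (`i_G(1) = v_𝔓(0) = ∞`).  By the uniformizer criterion
`mem_ramificationSubgroup_iff_smul_sub_mem_pow` (`g ∈ G_i ⇔ g π ≡ π mod 𝔓^{i+1}`), the residue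
classes being represented by the `G`-fixed elements of `R` (`f = 1`).
Ref: Serre, *Local Fields*, Ch. IV §1, Lemma 1 and Prop. 2 (p. 61–63: `i_G(s) = v_L(s π - π)`
in the totally ramified case); §2 Prop. 5. [cite: SerreLocalFields1979, Ch. IV §1 Lemma 1 and §2 Prop. 5] -/
theorem lowerIndex_eq_ord_smul_sub [IsDedekindDomain (integralClosure R L)] (h𝔓 : 𝔓 ≠ ⊥)
    (htot : 𝔓.inertia (L ≃ₐ[K] L) = ⊤) {π : integralClosure R L} (hπ : π ∈ 𝔓)
    (hπ2 : π ∉ 𝔓 ^ 2) (g : L ≃ₐ[K] L) :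
    lowerIndex 𝔓 (L ≃ₐ[K] L) g = ord 𝔓 (g • π - π) := by
  have hfix : ∀ b : integralClosure R L, ∃ a : integralClosure R L, g • a = a ∧ b - a ∈ 𝔓 := by
    intro b
    obtain ⟨a, ha⟩ := exists_algebraMap_sub_mem_of_inertia_eq_top R 𝔓 htot b
    exact ⟨_, smul_algebraMap g a, ha⟩
  have key : ∀ i : ℕ, g ∈ 𝔓.ramificationSubgroup (L ≃ₐ[K] L) i ↔ g • π - π ∈ 𝔓 ^ (i + 1) :=
    fun i => mem_ramificationSubgroup_iff_smul_sub_mem_pow 𝔓 h𝔓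
      (smul_eq_of_inertia_eq_top htot g) hfix hπ hπ2 i
  refine le_antisymm (ENat.le_of_forall_natCast_add_one_le fun i hi => ?_)
    (ENat.le_of_forall_natCast_add_one_le fun i hi => ?_)
  · rw [add_one_le_lowerIndex_iff, key, mem_pow_iff_le_ord] at hi
    exact_mod_cast hi
  · rw [add_one_le_lowerIndex_iff, key, mem_pow_iff_le_ord]
    exact_mod_cast hi

omit [IsDedekindDomain R] [IsFractionRing R K] [FiniteDimensional K L] [IsGalois K L] [𝔓.IsMaximal]
  [Algebra.IsSeparable (R ⧸ 𝔓.under R) (integralClosure R L ⧸ 𝔓)] in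
/-- `G_0 = G` at a totally ramified prime. [folklore] -/
theorem ramificationSubgroup_zero_eq_top (htot : 𝔓.inertia (L ≃ₐ[K] L) = ⊤) :
    𝔓.ramificationSubgroup (L ≃ₐ[K] L) 0 = ⊤ := by
  rw [Ideal.ramificationSubgroup_zero, htot]

omit [IsDedekindDomain R] [IsFractionRing R K] [FiniteDimensional K L] [IsGalois K L] [𝔓.IsMaximal]
  [Algebra.IsSeparable (R ⧸ 𝔓.under R) (integralClosure R L ⧸ 𝔓)] in
/-- **`g_j ∣ g_i` for `i ≤ j`** (the `G_i` decrease; Lagrange). Ref: Serre, *Local Fields*,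
Ch. IV §1, Prop. 1. [folklore] -/
theorem card_ramificationSubgroup_dvd {i j : ℕ} (hij : i ≤ j) :
    Nat.card (𝔓.ramificationSubgroup (L ≃ₐ[K] L) j) ∣
      Nat.card (𝔓.ramificationSubgroup (L ≃ₐ[K] L) i) :=
  Subgroup.card_dvd_of_le (𝔓.ramificationSubgroup_antitone (L ≃ₐ[K] L) hij)

omit [IsDedekindDomain R] [IsFractionRing R K] [FiniteDimensional K L] [IsGalois K L] [𝔓.IsMaximal]
  [Algebra.IsSeparable (R ⧸ 𝔓.under R) (integralClosure R L ⧸ 𝔓)] in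
/-- `g_i ∣ |G|`. Ref: Serre, *Local Fields*, Ch. IV §1, Prop. 1. [folklore] -/
theorem card_ramificationSubgroup_dvd_card (i : ℕ) :
    Nat.card (𝔓.ramificationSubgroup (L ≃ₐ[K] L) i) ∣ Nat.card (L ≃ₐ[K] L) :=
  Subgroup.card_subgroup_dvd_card _

omit [IsDedekindDomain R] [IsFractionRing R K] [FiniteDimensional K L] [IsGalois K L] [𝔓.IsMaximal]
  [Algebra.IsSeparable (R ⧸ 𝔓.under R) (integralClosure R L ⧸ 𝔓)] in
/-- `g_j` divides the partial sum `Σ_{i=1}^{m} g_i` for `m ≤ j`. [folklore] -/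
theorem card_ramificationSubgroup_dvd_sum {m j : ℕ} (hmj : m ≤ j) :
    Nat.card (𝔓.ramificationSubgroup (L ≃ₐ[K] L) j) ∣
      ∑ i ∈ Finset.range m, Nat.card (𝔓.ramificationSubgroup (L ≃ₐ[K] L) (i + 1)) :=
  Finset.dvd_sum fun i hi =>
    card_ramificationSubgroup_dvd R 𝔓 (by have := Finset.mem_range.mp hi; omega)

omit [IsDedekindDomain R] [IsFractionRing R K] [IsGalois K L] [𝔓.IsMaximal]
  [Algebra.IsSeparable (R ⧸ 𝔓.under R) (integralClosure R L ⧸ 𝔓)] in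
/-- **`ψ` maps integers to integers** (Serre IV §3 Prop. 13, in integer form): at a totally
ramified prime with faithful action of a finite group on a Noetherian domain (so that `G_i = 1`
for `i ≫ 0`), for every `n : ℕ` there is `m : ℕ` with `Σ_{i=1}^{m} g_i = |G| · n`, i.e.
`φ(m) = n`.  (The partial sums increase by steps `g_{m+1}` dividing both the previous sum and `|G|`,
and are unbounded.)
Ref: Serre, *Local Fields*, Ch. IV §3, Prop. 13 (d) ("if `v` is an integer, so is `ψ(v)`").
[cite: SerreLocalFields1979, Ch. IV §3 Prop. 13] -/
theorem exists_sum_card_ramificationSubgroup_eq_mul (n : ℕ) :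
    ∃ m : ℕ, ∑ i ∈ Finset.range m, Nat.card (𝔓.ramificationSubgroup (L ≃ₐ[K] L) (i + 1)) =
      Nat.card (L ≃ₐ[K] L) * n := by
  classical
  have hgpos : ∀ i, 1 ≤ Nat.card (𝔓.ramificationSubgroup (L ≃ₐ[K] L) (i + 1)) := fun i =>
    Nat.one_le_iff_ne_zero.mpr Nat.card_pos.ne'
  -- the partial sums are unbounded: `Σ_{i<m} g_{i+1} ≥ m`
  have hfm : ∀ m, m ≤ ∑ i ∈ Finset.range m, Nat.card (𝔓.ramificationSubgroup (L ≃ₐ[K] L) (i + 1)) :=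
    fun m => by
      calc m = ∑ _i ∈ Finset.range m, 1 := by simp
        _ ≤ _ := Finset.sum_le_sum fun i _ => hgpos i
  have hex : ∃ m, Nat.card (L ≃ₐ[K] L) * n ≤
      ∑ i ∈ Finset.range m, Nat.card (𝔓.ramificationSubgroup (L ≃ₐ[K] L) (i + 1)) := ⟨_, hfm _⟩
  refine ⟨Nat.find hex, le_antisymm ?_ (Nat.find_spec hex)⟩
  -- minimality of `m₀ = Nat.find hex`
  rcases Nat.eq_zero_or_pos (Nat.find hex) with h0 | hpos
  · rw [h0, Finset.sum_range_zero]; exact Nat.zero_le _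
  obtain ⟨m, hm⟩ : ∃ m, Nat.find hex = m + 1 := ⟨Nat.find hex - 1, by omega⟩
  have hlt : ∑ i ∈ Finset.range m, Nat.card (𝔓.ramificationSubgroup (L ≃ₐ[K] L) (i + 1)) <
      Nat.card (L ≃ₐ[K] L) * n := by
    have := Nat.find_min hex (show m < Nat.find hex by omega)
    rwa [not_le] at this
  rw [hm, Finset.sum_range_succ]
  -- `g_{m+1}` divides the previous partial sum and `|G| n`, hence their (positive) difference
  have hdvd1 : Nat.card (𝔓.ramificationSubgroup (L ≃ₐ[K] L) (m + 1)) ∣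
      ∑ i ∈ Finset.range m, Nat.card (𝔓.ramificationSubgroup (L ≃ₐ[K] L) (i + 1)) :=
    card_ramificationSubgroup_dvd_sum R 𝔓 (m := m) (j := m + 1) (by omega)
  have hdvd2 : Nat.card (𝔓.ramificationSubgroup (L ≃ₐ[K] L) (m + 1)) ∣ Nat.card (L ≃ₐ[K] L) * n :=
    (card_ramificationSubgroup_dvd_card R 𝔓 (m + 1)).mul_right n
  obtain ⟨q, hq⟩ := Nat.dvd_sub hdvd2 hdvd1
  have hq0 : q ≠ 0 := by
    rintro rfl
    rw [mul_zero] at hq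
    omega
  have : Nat.card (𝔓.ramificationSubgroup (L ≃ₐ[K] L) (m + 1)) ≤ Nat.card (L ≃ₐ[K] L) * n -
      ∑ i ∈ Finset.range m, Nat.card (𝔓.ramificationSubgroup (L ≃ₐ[K] L) (i + 1)) := by
    rw [hq]; exact Nat.le_mul_of_pos_right _ (Nat.pos_of_ne_zero hq0)
  omega

omit [IsDedekindDomain R] [IsFractionRing R K] [IsGalois K L] [𝔓.IsMaximal]
  [Algebra.IsSeparable (R ⧸ 𝔓.under R) (integralClosure R L ⧸ 𝔓)] in
/-- **Integrality of `φ(μ)` from a divisibility**: if `|G_0|` divides `Σ_{i=0}^{μ} |G_i|` then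
`φ(μ)` is a natural number, by `|G_0| (φ(μ) + 1) = Σ_{i=0}^{μ} |G_i|`
(`card_mul_herbrandPhi_natCast_add_one`).  This is the form in which Serre's Prop. V.11 is proved
in the sequel.  Ref: Serre, *Local Fields*, Ch. IV §3, p. 74 (`φ(m) + 1 = g_0⁻¹ Σ_{i=0}^{m} g_i`).
[cite: SerreLocalFields1979, Ch. IV §3 (p. 74)] -/
theorem exists_natCast_eq_herbrandPhi_of_dvd (μ : ℕ)
    (hdvd : Nat.card (𝔓.ramificationSubgroup (L ≃ₐ[K] L) 0) ∣
      ∑ i ∈ Finset.range (μ + 1), Nat.card (𝔓.ramificationSubgroup (L ≃ₐ[K] L) i)) :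
    ∃ n : ℕ, (n : ℝ) = herbrandPhi 𝔓 (L ≃ₐ[K] L) μ := by
  obtain ⟨q, hq⟩ := hdvd
  have h0 : (Nat.card (𝔓.ramificationSubgroup (L ≃ₐ[K] L) 0) : ℝ) ≠ 0 :=
    (Nat.cast_pos.mpr Nat.card_pos).ne'
  have key := card_mul_herbrandPhi_natCast_add_one 𝔓 (L ≃ₐ[K] L) μ
  rw [← Nat.cast_sum, hq, Nat.cast_mul, mul_eq_mul_left_iff] at key
  rcases key with key | key
  · have hq1 : 1 ≤ q := by
      by_contra hq0
      push Not at hq0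
      interval_cases q
      have : herbrandPhi 𝔓 (L ≃ₐ[K] L) μ + 1 = 0 := by exact_mod_cast key
      have := herbrandPhi_mono 𝔓 (L ≃ₐ[K] L) (Nat.cast_nonneg μ : (0 : ℝ) ≤ μ)
      rw [herbrandPhi_zero] at this
      linarith
    refine ⟨q - 1, ?_⟩
    rw [Nat.cast_sub hq1, Nat.cast_one]
    linarith
  · exact absurd key h0

end LowerNumbering

end Literature.NumberTheory.GaloisRepresentations

end
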